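import Literature.Analysis.Complex.StaircaseContour
import HarnessLib

/-!
# The symmetric staircase with a middle block (bookkeeping for Soundararajan's contour)

Topic `Literature/Analysis/Complex`, companion of `StaircaseContour.lean`. Soundararajan's path
`𝒮_N` for `M(x)` (arXiv:0705.0723 §5; Balazard–de Roton, arXiv:0810.3587 §8.2 and arXiv:0812.1689
§6.2) replaces the Perron segment `[c − iT, c + iT]` by: one vertical segment `Re z = s₀` on
`|Im z| ≤ N₀`; for every integer `N₀ ≤ n < T` the two vertical unit segments `Re z = σ_n`,
`n ≤ ±Im z ≤ n + 1`; and the horizontal connectors at the heights `±N₀`, `±(n+1)` (`N₀ ≤ n ≤ T − 2`)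
and `±T` (the last two going back to the abscissa `c`). This file specializes the general
staircase bound `Literature.Analysis.Complex.Staircase.norm_integral_vertical_le` (Cauchy's theorem
rectangle by rectangle, for `f` holomorphic on `Re z > a`) to this symmetric layout and re-indexes
its four sums by the integer `n` (`StaircaseSymm.norm_integral_symm_staircase_le`): a pure
finite-sum manipulation, no analysis beyond the cited bound.

## References

* K. Soundararajan, Partial sums of the Möbius function, J. reine angew. Math. 631 (2009), §5.
* [BalazardRoton2008] M. Balazard, A. de Roton, arXiv:0810.3587, §8.2 (description of `𝒮_N`).
* [BalazardDeRoton2010] M. Balazard, A. de Roton, arXiv:0812.1689, §6.2 ("Deuxième étape").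
-/

noncomputable section

open Complex Set MeasureTheory intervalIntegral
open scoped Interval

namespace Literature.Analysis.Complex

namespace StaircaseSymm

variable {f : ℂ → ℂ} {a c : ℝ}

/-- **The symmetric staircase bound.** Let `f` be holomorphic on `Re z > a`, `c > a`, integers
`N₀ < T`, abscissae `σ n > a` (`N₀ ≤ n < T`) and `s₀ > a`. Then `‖∫_{-T}^{T} f(c+iu) du‖` is at most
the sum of: the `L¹` norms of `f` on the vertical unit segments `Re z = σ_n`, `Im z ∈ [n, n+1]` and
`Im z ∈ [−(n+1), −n]` (`N₀ ≤ n < T`); on the horizontal connectors at heights `±(n+1)` between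
`σ_n` and `σ_{n+1}` (`N₀ ≤ n < T − 1`); on the middle segment `Re z = s₀`, `|Im z| ≤ N₀`; on the two
connectors at heights `±N₀` between `s₀` and `σ_{N₀}`; and on the two end connectors at heights
`±T` between `σ_{T−1}` and `c`. [cite: BalazardRoton2008, §8.2] -/
theorem norm_integral_symm_staircase_le (hf : DifferentiableOn ℂ f {z : ℂ | a < z.re}) (hc : a < c)
    {N₀ T : ℕ} (hNT : N₀ < T) (σ : ℕ → ℝ) (hσ : ∀ n, a < σ n) {s₀ : ℝ} (hs₀ : a < s₀) :
    ‖∫ u in (-(T : ℝ))..T, f (c + u * I)‖ ≤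
      (∑ n ∈ Finset.Ico N₀ T, (|∫ u in (n : ℝ)..((n : ℝ) + 1), ‖f (σ n + u * I)‖| +
          |∫ u in (-((n : ℝ) + 1))..(-(n : ℝ)), ‖f (σ n + u * I)‖|)) +
      (∑ n ∈ Finset.Ico N₀ (T - 1), (|∫ v in (σ n)..(σ (n + 1)), ‖f (v + (((n : ℝ) + 1 : ℝ) : ℂ) * I)‖| +
          |∫ v in (σ (n + 1))..(σ n), ‖f (v + ((-((n : ℝ) + 1) : ℝ) : ℂ) * I)‖|)) +
      |∫ u in (-(N₀ : ℝ))..N₀, ‖f (s₀ + u * I)‖| +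
      (|∫ v in s₀..(σ N₀), ‖f (v + ((N₀ : ℝ) : ℂ) * I)‖| +
        |∫ v in (σ N₀)..s₀, ‖f (v + ((-(N₀ : ℝ) : ℝ) : ℂ) * I)‖|) +
      (|∫ v in (σ (T - 1))..c, ‖f (v + ((T : ℝ) : ℂ) * I)‖| +
        |∫ v in (σ (T - 1))..c, ‖f (v + ((-(T : ℝ) : ℝ) : ℂ) * I)‖|) := by
  -- the layout
  set M₀ : ℕ := T - N₀ with hM₀def
  have hM₀ : 1 ≤ M₀ := by omega
  have hM₀T : (M₀ : ℝ) = T - N₀ := by rw [hM₀def, Nat.cast_sub hNT.le]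
  set t : ℕ → ℝ := fun j ↦ if j ≤ M₀ then (j : ℝ) - T else (j : ℝ) - M₀ - 1 + N₀ with htdef
  set s : ℕ → ℝ := fun j ↦ if j < M₀ then σ (T - 1 - j) else if j = M₀ then s₀
    else σ (N₀ + (j - M₀ - 1)) with hsdef
  have hs : ∀ j, a < s j := by
    intro j
    simp only [hsdef]
    split_ifs
    · exact hσ _
    · exact hs₀
    · exact hσ _
  -- values of `t` and `s`
  have ht_lo : ∀ k, k ≤ M₀ → t k = (k : ℝ) - T := fun k hk ↦ by simp [htdef, hk]
  have ht_hi : ∀ k, t (M₀ + 1 + k) = (N₀ : ℝ) + k := fun k ↦ by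
    have : ¬(M₀ + 1 + k ≤ M₀) := by omega
    simp only [htdef, this, if_false]
    push_cast; ring
  have hs_lo : ∀ k, k < M₀ → s k = σ (T - 1 - k) := fun k hk ↦ by simp [hsdef, hk]
  have hs_mid : s M₀ = s₀ := by simp [hsdef]
  have hs_hi : ∀ k, s (M₀ + 1 + k) = σ (N₀ + k) := fun k ↦ by
    have h1 : ¬(M₀ + 1 + k < M₀) := by omega
    have h2 : M₀ + 1 + k ≠ M₀ := by omega
    simp only [hsdef, h1, h2, if_false]
    congr 1; omega
  have ht0 : t 0 = -(T : ℝ) := by rw [ht_lo 0 (Nat.zero_le _)]; simp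
  have htm : t (2 * M₀ + 1) = T := by
    rw [show 2 * M₀ + 1 = M₀ + 1 + M₀ by ring, ht_hi, hM₀T]; ring
  have htM₀ : t M₀ = -(N₀ : ℝ) := by rw [ht_lo M₀ le_rfl, hM₀T]; ring
  have htM₀1 : t (M₀ + 1) = N₀ := by
    have := ht_hi 0; simpa using this
  -- the general bound
  have key := Staircase.norm_integral_vertical_le hf hc s t hs (m := 2 * M₀ + 1) (by omega)
  rw [ht0, htm] at key
  -- (1) vertical pieces
  have h1 : (∑ j ∈ Finset.range (2 * M₀ + 1), |∫ u in (t j)..(t (j + 1)), ‖f (s j + u * I)‖|) =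
      (∑ n ∈ Finset.Ico N₀ T, (|∫ u in (n : ℝ)..((n : ℝ) + 1), ‖f (σ n + u * I)‖| +
          |∫ u in (-((n : ℝ) + 1))..(-(n : ℝ)), ‖f (σ n + u * I)‖|)) +
        |∫ u in (-(N₀ : ℝ))..N₀, ‖f (s₀ + u * I)‖| := by
    rw [show 2 * M₀ + 1 = M₀ + 1 + M₀ by ring, Finset.sum_range_add, Finset.sum_range_succ,
      Finset.sum_add_distrib]
    -- lower blocks
    have hA : (∑ k ∈ Finset.range M₀, |∫ u in (t k)..(t (k + 1)), ‖f (s k + u * I)‖|) =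
        ∑ n ∈ Finset.Ico N₀ T, |∫ u in (-((n : ℝ) + 1))..(-(n : ℝ)), ‖f (σ n + u * I)‖| := by
      rw [Finset.sum_Ico_eq_sum_range, ← hM₀def]
      rw [← Finset.sum_range_reflect]
      refine Finset.sum_congr rfl fun k hk ↦ ?_
      rw [Finset.mem_range] at hk
      have hk' : M₀ - 1 - k < M₀ := by omega
      rw [ht_lo _ hk'.le, ht_lo _ (by omega), hs_lo _ hk']
      have e1 : T - 1 - (M₀ - 1 - k) = N₀ + k := by omega
      have e2 : ((M₀ - 1 - k : ℕ) : ℝ) = (M₀ : ℝ) - 1 - k := by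
        rw [Nat.cast_sub (by omega), Nat.cast_sub hM₀]; simp
      have ea : ((M₀ - 1 - k : ℕ) : ℝ) - T = -(((N₀ + k : ℕ) : ℝ) + 1) := by
        rw [e2, hM₀T]; push_cast; ring
      have eb : ((M₀ - 1 - k + 1 : ℕ) : ℝ) - T = -((N₀ + k : ℕ) : ℝ) := by
        push_cast; rw [e2, hM₀T]; ring
      rw [e1, ea, eb]
    -- upper blocks
    have hB : (∑ k ∈ Finset.range M₀, |∫ u in (t (M₀ + 1 + k))..(t (M₀ + 1 + k + 1)),
        ‖f (s (M₀ + 1 + k) + u * I)‖|) =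
        ∑ n ∈ Finset.Ico N₀ T, |∫ u in (n : ℝ)..((n : ℝ) + 1), ‖f (σ n + u * I)‖| := by
      rw [Finset.sum_Ico_eq_sum_range, ← hM₀def]
      refine Finset.sum_congr rfl fun k _ ↦ ?_
      rw [ht_hi, show M₀ + 1 + k + 1 = M₀ + 1 + (k + 1) by ring, ht_hi, hs_hi]
      push_cast; ring_nf
    rw [hA, hB, htM₀, htM₀1, hs_mid]
    ring
  -- (2) connectors
  have h2 : (∑ j ∈ Finset.Ico 1 (2 * M₀ + 1), |∫ v in (s (j - 1))..(s j), ‖f (v + t j * I)‖|) =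
      (∑ n ∈ Finset.Ico N₀ (T - 1), (|∫ v in (σ n)..(σ (n + 1)), ‖f (v + (((n : ℝ) + 1 : ℝ) : ℂ) * I)‖| +
          |∫ v in (σ (n + 1))..(σ n), ‖f (v + ((-((n : ℝ) + 1) : ℝ) : ℂ) * I)‖|)) +
      (|∫ v in s₀..(σ N₀), ‖f (v + ((N₀ : ℝ) : ℂ) * I)‖| +
        |∫ v in (σ N₀)..s₀, ‖f (v + ((-(N₀ : ℝ) : ℝ) : ℂ) * I)‖|) := by
    set B : ℕ → ℝ := fun j ↦ |∫ v in (s (j - 1))..(s j), ‖f (v + t j * I)‖| with hBdef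
    have hsplit : (∑ j ∈ Finset.Ico 1 (2 * M₀ + 1), B j) =
        (∑ j ∈ Finset.Ico 1 M₀, B j) + B M₀ + B (M₀ + 1) + ∑ j ∈ Finset.Ico (M₀ + 2) (2 * M₀ + 1), B j := by
      rw [← Finset.sum_Ico_consecutive B (show 1 ≤ M₀ from hM₀) (show M₀ ≤ 2 * M₀ + 1 by omega),
        ← Finset.sum_Ico_consecutive B (show M₀ ≤ M₀ + 1 by omega) (show M₀ + 1 ≤ 2 * M₀ + 1 by omega),
        ← Finset.sum_Ico_consecutive B (show M₀ + 1 ≤ M₀ + 2 by omega) (show M₀ + 2 ≤ 2 * M₀ + 1 by omega),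
        Finset.sum_Ico_succ_top (show M₀ ≤ M₀ from le_rfl), Finset.Ico_self, Finset.sum_empty, zero_add,
        Finset.sum_Ico_succ_top (show M₀ + 1 ≤ M₀ + 1 from le_rfl), Finset.Ico_self, Finset.sum_empty,
        zero_add]
      ring
    rw [hsplit]
    -- lower connectors: j ∈ [1, M₀), n = T − 1 − j
    have hA : (∑ j ∈ Finset.Ico 1 M₀, B j) =
        ∑ n ∈ Finset.Ico N₀ (T - 1), |∫ v in (σ (n + 1))..(σ n), ‖f (v + ((-((n : ℝ) + 1) : ℝ) : ℂ) * I)‖| := by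
      rw [Finset.sum_Ico_eq_sum_range, Finset.sum_Ico_eq_sum_range,
        show T - 1 - N₀ = M₀ - 1 by omega, ← Finset.sum_range_reflect]
      refine Finset.sum_congr rfl fun k hk ↦ ?_
      rw [Finset.mem_range] at hk
      simp only [hBdef]
      have hj : 1 + (M₀ - 1 - 1 - k) < M₀ := by omega
      rw [hs_lo _ hj, hs_lo _ (by omega), ht_lo _ hj.le]
      have e1 : T - 1 - (1 + (M₀ - 1 - 1 - k) - 1) = N₀ + k + 1 := by omega
      have e2 : T - 1 - (1 + (M₀ - 1 - 1 - k)) = N₀ + k := by omega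
      have e3 : ((1 + (M₀ - 1 - 1 - k) : ℕ) : ℝ) = (M₀ : ℝ) - 1 - k := by
        rw [Nat.cast_add, Nat.cast_sub (by omega), Nat.cast_sub (by omega), Nat.cast_sub hM₀]
        simp; ring
      rw [e1, e2, e3, hM₀T]
      congr 2
      ext v
      congr 2
      push_cast; ring
    -- upper connectors: j = M₀ + 2 + k, n = N₀ + k
    have hD : (∑ j ∈ Finset.Ico (M₀ + 2) (2 * M₀ + 1), B j) =
        ∑ n ∈ Finset.Ico N₀ (T - 1), |∫ v in (σ n)..(σ (n + 1)), ‖f (v + (((n : ℝ) + 1 : ℝ) : ℂ) * I)‖| := by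
      rw [Finset.sum_Ico_eq_sum_range, Finset.sum_Ico_eq_sum_range,
        show 2 * M₀ + 1 - (M₀ + 2) = M₀ - 1 by omega, show T - 1 - N₀ = M₀ - 1 by omega]
      refine Finset.sum_congr rfl fun k _ ↦ ?_
      simp only [hBdef]
      rw [show M₀ + 2 + k - 1 = M₀ + 1 + k by omega, show M₀ + 2 + k = M₀ + 1 + (k + 1) by omega,
        hs_hi, hs_hi, ht_hi, show N₀ + (k + 1) = N₀ + k + 1 by ring]
      congr 2
      ext v
      congr 2
      push_cast; ring
    -- the two middle connectors
    have hBm : B M₀ = |∫ v in (σ N₀)..s₀, ‖f (v + ((-(N₀ : ℝ) : ℝ) : ℂ) * I)‖| := by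
      simp only [hBdef]
      rw [hs_lo _ (by omega), hs_mid, htM₀, show T - 1 - (M₀ - 1) = N₀ by omega]
    have hBm1 : B (M₀ + 1) = |∫ v in s₀..(σ N₀), ‖f (v + ((N₀ : ℝ) : ℂ) * I)‖| := by
      simp only [hBdef]
      rw [show M₀ + 1 - 1 = M₀ from rfl, hs_mid, htM₀1, show M₀ + 1 = M₀ + 1 + 0 from rfl, hs_hi,
        Nat.add_zero]
    rw [hA, hD, hBm, hBm1, Finset.sum_add_distrib]
    ring
  -- (3), (4) ends
  have h3 : s (2 * M₀ + 1 - 1) = σ (T - 1) := by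
    rw [show 2 * M₀ + 1 - 1 = M₀ + 1 + (M₀ - 1) by omega, hs_hi]
    congr 1; omega
  have h4 : s 0 = σ (T - 1) := by rw [hs_lo 0 (by omega), Nat.sub_zero]
  rw [h1, h2, h3, h4] at key
  linarith [key]

end StaircaseSymm

end Literature.Analysis.Complex

end
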